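import Summits.ABC.ABC.Theorems.TwistAmplificationSharpModerateLawTwistMinimalInversionLemmas
import Mathlib.NumberTheory.Harmonic.Bounds

/-!
# Crux `TwistAmplification.SharpModerateLaw` (stmt-ABC-1975): the twist-orbit inversion (stub `stub_inversion`)

Lead `prover-line-stmt-ABC-1975-c6-0`, skeleton v5 (line `unit-plane-conic-two-torsion`, reshaped).
**`stub_inversion : TwistDecomposition → TwistScaling → TwistOrbitInversion`**, i.e. given the twist dictionary,
`CoreLawTM → PointwiseSzpiroCusp → CoreLaw`: the canonical core of the crux is the core law on TWIST-MINIMAL pairs plus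
generalized Szpiro in cusp form (which is the summit, `pointwiseSzpiroCusp_iff_abc`).

Proof (elementary; the strategist's half page, `Cruxes/SharpModerateLaw/STRATEGY-CENSUS.md` §4). Fix `3 < κ₀ < σ`, `ε > 0`;
put `κ₁ = min κ₀ 4`, `η = min ε 1`, `σ₁ = 6 + 2η`. By the cover (`ncard_cuspShell_le_sum_twist`)
`#cuspShell(X,Y) ≤ Σ_{d² ≤ X} #S_d`, `S_d = TM ∩ cuspShell(X/d², Y/d⁶)`.
* Fibres under the cap `Y/d⁶ ≤ (X/d²)^{σ₁}`: `CoreLawTM(κ₁, σ₁, ε/2)` gives `#S_d ≤ C₁ (XY)^{ε/2} (XY^{-1/6}/d + 1)`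
  (`twistFibre_main`); the harmonic sum is `≤ 1 + log X ≤ (1 + 2/ε)(XY)^{ε/2}` and the number of such `d` is
  `≤ (X^{σ₁}/Y)^{1/(2σ₁−6)} = X^{1−3θ} Y^{θ−1/6} ≤ XY^{-1/6}(XY)^{θ}`, `θ = 2η/(3(6+4η)) ≤ ε/2`.
* Fibres beyond the cap: pointwise Szpiro at `η` puts `S_d` inside a fixed finite box and forces `d < D_B`
  (`twistFibre_tail_subset`, `twistFibre_tail_d_lt`): `O(1)` in total.
-/

noncomputable section

-- the mandated summit namespace `Summit.ABC.ABC` (summit = problem) trips the duplicate-namespace linter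
set_option linter.dupNamespace false

namespace Summit.ABC.ABC.Theorems.SharpModerateLaw

open Finset

/-- `1 + log X ≤ (1 + 2/ε) · X^{ε/2}` for `X ≥ 1`, `ε > 0` (from `log X ≤ X^{ε/2}/(ε/2)`). -/
theorem one_add_log_le_mul_rpow_half {X ε : ℝ} (hX : 1 ≤ X) (hε : 0 < ε) :
    1 + Real.log X ≤ (1 + 2 / ε) * X ^ (ε / 2) := by
  have h1 : Real.log X ≤ X ^ (ε / 2) / (ε / 2) := Real.log_le_rpow_div (by linarith) (by positivity)
  have h2 : (1 : ℝ) ≤ X ^ (ε / 2) := Real.one_le_rpow hX (by positivity)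
  have h3 : X ^ (ε / 2) / (ε / 2) = 2 / ε * X ^ (ε / 2) := by field_simp
  nlinarith [h1, h2, h3, div_pos two_pos hε]

/-- The cap count: if `1 ≤ d` and `Y/d⁶ ≤ (X/d²)^{6+2η}` (`X, Y > 0`, `η > 0`), then
`d ≤ X^{(6+2η)/(6+4η)} · Y^{-1/(6+4η)}`. -/
theorem natCast_le_of_cap {η X Y : ℝ} {d : ℕ} (hη : 0 < η) (hX : 0 < X) (hY : 0 < Y) (hd : 1 ≤ d)
    (hcap : Y / (d : ℝ) ^ 6 ≤ (X / (d : ℝ) ^ 2) ^ (6 + 2 * η)) :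
    (d : ℝ) ≤ X ^ ((6 + 2 * η) / (6 + 4 * η)) * Y ^ (-(1 / (6 + 4 * η))) := by
  have hdR1 : (1 : ℝ) ≤ d := by exact_mod_cast hd
  have hdR0 : (0 : ℝ) < d := by linarith
  have h46 : (0 : ℝ) < 6 + 4 * η := by linarith
  set s : ℝ := 6 + 2 * η with hs
  have hs0 : 0 < s := by rw [hs]; linarith
  -- `Y d^{2s} ≤ X^s d^6`, i.e. `d^{2s-6} ≤ X^s / Y`
  have h1 : Y * (d : ℝ) ^ (2 * s) ≤ X ^ s * (d : ℝ) ^ 6 := by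
    have h := hcap
    rw [Real.div_rpow hX.le (by positivity), div_le_div_iff₀ (by positivity) (Real.rpow_pos_of_pos (by positivity) s)]
      at h
    have hd2s : ((d : ℝ) ^ 2) ^ s = (d : ℝ) ^ (2 * s) := by
      rw [← Real.rpow_natCast d 2, ← Real.rpow_mul hdR0.le]; push_cast; ring_nf
    rw [hd2s] at h
    linarith
  have h2 : (d : ℝ) ^ (2 * s - 6) ≤ X ^ s / Y := by
    rw [le_div_iff₀ hY]
    have hsplit : (d : ℝ) ^ (2 * s) = (d : ℝ) ^ (2 * s - 6) * (d : ℝ) ^ 6 := by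
      rw [← Real.rpow_natCast d 6, ← Real.rpow_add hdR0]; congr 1; push_cast; ring
    have h6 : (0 : ℝ) < (d : ℝ) ^ 6 := by positivity
    have : (d : ℝ) ^ (2 * s - 6) * (d : ℝ) ^ 6 * Y ≤ X ^ s * (d : ℝ) ^ 6 := by
      calc (d : ℝ) ^ (2 * s - 6) * (d : ℝ) ^ 6 * Y = Y * (d : ℝ) ^ (2 * s) := by rw [hsplit]; ring
        _ ≤ X ^ s * (d : ℝ) ^ 6 := h1
    have h7 : (d : ℝ) ^ (2 * s - 6) * Y * (d : ℝ) ^ 6 ≤ X ^ s * (d : ℝ) ^ 6 := by linarith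
    exact le_of_mul_le_mul_right h7 h6
  -- take the `1/(2s-6)`-th power
  have h2s6 : 2 * s - 6 = 6 + 4 * η := by rw [hs]; ring
  have h3 : (d : ℝ) = ((d : ℝ) ^ (2 * s - 6)) ^ (1 / (2 * s - 6)) := by
    rw [← Real.rpow_mul hdR0.le, mul_one_div_cancel (by rw [h2s6]; exact h46.ne'), Real.rpow_one]
  rw [h3]
  calc ((d : ℝ) ^ (2 * s - 6)) ^ (1 / (2 * s - 6))
      ≤ (X ^ s / Y) ^ (1 / (2 * s - 6)) :=
        Real.rpow_le_rpow (Real.rpow_nonneg hdR0.le _) h2 (by rw [h2s6]; positivity)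
    _ = X ^ ((6 + 2 * η) / (6 + 4 * η)) * Y ^ (-(1 / (6 + 4 * η))) := by
        rw [Real.div_rpow (Real.rpow_nonneg hX.le _) hY.le, ← Real.rpow_mul hX.le, h2s6, hs,
          div_eq_mul_inv, ← Real.rpow_neg hY.le]
        congr 1
        ring_nf

/-- The cap count is below the law: `X^{(6+2η)/(6+4η)} Y^{-1/(6+4η)} ≤ X · Y^{-1/6} · (XY)^{ε/2}` for `X, Y ≥ 1`,
`0 < η ≤ ε` (the exponent `θ = 2η/(3(6+4η))` by which the cap count exceeds `XY^{-1/6}` on `Y/X³` is `≤ η/9`). -/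
theorem cap_le_law {η ε X Y : ℝ} (hη : 0 < η) (hηε : η ≤ ε) (hX : 1 ≤ X) (hY : 1 ≤ Y) :
    X ^ ((6 + 2 * η) / (6 + 4 * η)) * Y ^ (-(1 / (6 + 4 * η))) ≤
      X * Y ^ (-(1 / 6 : ℝ)) * (X * Y) ^ (ε / 2) := by
  have hX0 : 0 < X := by linarith
  have hY0 : 0 < Y := by linarith
  have h46 : (0 : ℝ) < 6 + 4 * η := by linarith
  set θ : ℝ := 2 * η / (3 * (6 + 4 * η)) with hθ
  have hθ0 : 0 ≤ θ := by rw [hθ]; positivity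
  have hθε : θ ≤ ε / 2 := by
    rw [hθ, div_le_iff₀ (by positivity)]
    nlinarith
  have he1 : (6 + 2 * η) / (6 + 4 * η) = 1 - 3 * θ := by rw [hθ]; field_simp; ring
  have he2 : -(1 / (6 + 4 * η)) = θ - 1 / 6 := by rw [hθ]; field_simp; ring
  rw [he1, he2]
  -- `X^{1-3θ} ≤ X^{1+θ}` and `Y^{θ-1/6} = Y^{-1/6} Y^θ`, `(XY)^{θ} ≤ (XY)^{ε/2}`
  have h1 : X ^ (1 - 3 * θ) ≤ X ^ (1 + θ) := Real.rpow_le_rpow_of_exponent_le hX (by linarith)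
  have h2 : X ^ (1 + θ) = X * X ^ θ := by rw [Real.rpow_add hX0, Real.rpow_one]
  have h3 : Y ^ (θ - 1 / 6) = Y ^ (-(1 / 6 : ℝ)) * Y ^ θ := by
    rw [← Real.rpow_add hY0]; congr 1; ring
  have h4 : X ^ θ * Y ^ θ = (X * Y) ^ θ := (Real.mul_rpow hX0.le hY0.le).symm
  have h5 : (X * Y) ^ θ ≤ (X * Y) ^ (ε / 2) :=
    Real.rpow_le_rpow_of_exponent_le (one_le_mul_of_one_le_of_one_le hX hY) hθε
  have hYθ : 0 ≤ Y ^ (θ - 1 / 6) := Real.rpow_nonneg hY0.le _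
  calc X ^ (1 - 3 * θ) * Y ^ (θ - 1 / 6) ≤ X ^ (1 + θ) * Y ^ (θ - 1 / 6) :=
        mul_le_mul_of_nonneg_right h1 hYθ
    _ = X * Y ^ (-(1 / 6 : ℝ)) * (X * Y) ^ θ := by rw [h2, h3, ← h4]; ring
    _ ≤ X * Y ^ (-(1 / 6 : ℝ)) * (X * Y) ^ (ε / 2) :=
        mul_le_mul_of_nonneg_left h5 (by positivity)

/-- **The twist-orbit inversion** (registered stub `stub_inversion` of skeleton v5): given the twist dictionary
(`TwistDecomposition`, `TwistScaling`), the core law on twist-minimal pairs and pointwise Szpiro in cusp form give the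
full core law `CoreLaw`. -/
theorem stub_inversion : TwistDecomposition → TwistScaling → TwistOrbitInversion := by
  intro hdec hsc hTM hPW κ₀ σ hκ₀ _hκσ ε hε
  classical
  -- parameters
  set κ₁ : ℝ := min κ₀ 4 with hκ₁
  have hκ₁3 : 3 < κ₁ := lt_min hκ₀ (by norm_num)
  have hκ₁4 : κ₁ ≤ 4 := min_le_right _ _
  have hκ₁0 : κ₁ ≤ κ₀ := min_le_left _ _
  set η : ℝ := min ε 1 with hηdef
  have hη0 : 0 < η := lt_min hε one_pos
  have hηε : η ≤ ε := min_le_left _ _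
  have hκσ₁ : κ₁ < 6 + 2 * η := by linarith
  -- the two laws, with nonnegative / positive constants
  obtain ⟨C₁', hC₁'⟩ := hTM κ₁ (6 + 2 * η) hκ₁3 hκσ₁ (ε / 2) (by positivity)
  set C₁ : ℝ := max C₁' 0 with hC₁def
  have hC₁0 : 0 ≤ C₁ := le_max_right _ _
  have hC₁ : ∀ X Y : ℝ, 1 ≤ X → 1 ≤ Y → X ^ κ₁ ≤ Y → Y ≤ X ^ (6 + 2 * η) →
      (Set.ncard {x : ℤ × ℤ | x ∈ cuspShell X Y ∧ IsTwistMinimal x} : ℝ) ≤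
        C₁ * (X * Y) ^ (ε / 2) * (X * Y ^ (-(1 / 6 : ℝ)) + 1) := by
    intro X Y hX hY hlo hhi
    refine (hC₁' X Y hX hY hlo hhi).trans ?_
    have hX0 : 0 ≤ X := by linarith
    have hY0 : 0 ≤ Y := by linarith
    apply mul_le_mul_of_nonneg_right (mul_le_mul_of_nonneg_right (le_max_left _ _) (by positivity))
    positivity
  obtain ⟨C₂', hC₂'⟩ := hPW η hη0
  set C₂ : ℝ := max C₂' 1 with hC₂def
  have hC₂0 : 0 < C₂ := lt_of_lt_of_le one_pos (le_max_right _ _)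
  have hC₂ : ∀ x : ℤ × ℤ, x.1 ≠ 0 → x.2 ≠ 0 → x.1 ^ 3 ≠ x.2 ^ 2 → (1728 : ℤ) ∣ x.1 ^ 3 - x.2 ^ 2 → TF x →
      (Mcusp x : ℝ) ≤ C₂ * (N5cusp x : ℝ) ^ (6 + η) := fun x h1 h2 h3 h4 h5 =>
    (hC₂' x h1 h2 h3 h4 h5).trans (mul_le_mul_of_nonneg_right (le_max_left _ _) (by positivity))
  -- the tail constants
  set B' : ℝ := C₂ * (C₂ ^ (1 / η)) ^ (6 + η) + 1 with hB'
  set DB : ℝ := B' ^ (1 / (2 * κ₁ - 6)) with hDB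
  have hDB0 : 0 ≤ DB := Real.rpow_nonneg (by positivity) _
  set F : Set (ℤ × ℤ) := {x' : ℤ × ℤ | (1728 : ℤ) ∣ x'.1 ^ 3 - x'.2 ^ 2 ∧ (Mcusp x' : ℝ) < B'} with hF
  have hFfin : F.Finite := box_finite B'
  set KB : ℝ := (DB + 1) * (F.ncard : ℝ) with hKB
  have hKB0 : 0 ≤ KB := by positivity
  -- the constant
  refine ⟨C₁ * (2 + 2 / ε) + KB, fun X Y hX hY hlo _hhi => ?_⟩
  have hX0 : 0 < X := by linarith
  have hY0 : 0 < Y := by linarith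
  have hXY1 : 1 ≤ X * Y := one_le_mul_of_one_le_of_one_le hX hY
  have hκ₁Y : X ^ κ₁ ≤ Y := le_trans (Real.rpow_le_rpow_of_exponent_le hX hκ₁0) hlo
  -- the fibres and the cover
  set I : Finset ℕ := Finset.Icc 1 (Nat.sqrt ⌊X⌋₊) with hI
  set S : ℕ → Set (ℤ × ℤ) := fun d =>
    {x' : ℤ × ℤ | x' ∈ cuspShell (X / (d : ℝ) ^ 2) (Y / (d : ℝ) ^ 6) ∧ IsTwistMinimal x'} with hS
  have hcover : ((cuspShell X Y).ncard : ℝ) ≤ ∑ d ∈ I, ((S d).ncard : ℝ) := by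
    have h : ((cuspShell X Y).ncard : ℝ) ≤ ((∑ d ∈ I, (S d).ncard : ℕ) : ℝ) :=
      Nat.cast_le.mpr (ncard_cuspShell_le_sum_twist hdec hsc X Y)
    rwa [Nat.cast_sum] at h
  have hImem : ∀ d ∈ I, 1 ≤ d ∧ (d : ℝ) ^ 2 ≤ X := by
    intro d hd
    obtain ⟨hd1, hd2⟩ := Finset.mem_Icc.mp hd
    refine ⟨hd1, ?_⟩
    have h := Nat.le_sqrt.mp hd2
    have h' : ((d * d : ℕ) : ℝ) ≤ ⌊X⌋₊ := by exact_mod_cast h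
    calc (d : ℝ) ^ 2 = ((d * d : ℕ) : ℝ) := by push_cast; ring
      _ ≤ ⌊X⌋₊ := h'
      _ ≤ X := Nat.floor_le hX0.le
  -- split by the cap
  set P : ℕ → Prop := fun d => Y / (d : ℝ) ^ 6 ≤ (X / (d : ℝ) ^ 2) ^ (6 + 2 * η) with hP
  have hsplit : ∑ d ∈ I, ((S d).ncard : ℝ) =
      ∑ d ∈ I.filter P, ((S d).ncard : ℝ) + ∑ d ∈ I.filter (fun d => ¬ P d), ((S d).ncard : ℝ) :=
    (Finset.sum_filter_add_sum_filter_not I P _).symm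
  -- (A) the main-term fibres
  have hA : ∑ d ∈ I.filter P, ((S d).ncard : ℝ) ≤ C₁ * (2 + 2 / ε) * (X * Y) ^ ε * (X * Y ^ (-(1 / 6 : ℝ))) := by
    -- termwise
    have hterm : ∀ d ∈ I.filter P, ((S d).ncard : ℝ) ≤
        C₁ * (X * Y) ^ (ε / 2) * (X * Y ^ (-(1 / 6 : ℝ)) / d + 1) := by
      intro d hd
      obtain ⟨hdI, hdP⟩ := Finset.mem_filter.mp hd
      obtain ⟨hd1, hdX⟩ := hImem d hdI
      exact twistFibre_main hC₁ hC₁0 (by positivity) hκ₁3.le hX hκ₁Y hd1 hdX hdP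
    have hsumA := Finset.sum_le_sum hterm
    -- evaluate the right-hand sum
    have hH : ∑ d ∈ I.filter P, ((d : ℝ))⁻¹ ≤ (1 + 2 / ε) * (X * Y) ^ (ε / 2) := by
      have h1 : ∑ d ∈ I.filter P, ((d : ℝ))⁻¹ ≤ ∑ d ∈ I, ((d : ℝ))⁻¹ :=
        Finset.sum_le_sum_of_subset_of_nonneg (Finset.filter_subset _ _) fun d _ _ => by positivity
      -- harmonic sum `Σ_{d ≤ n} 1/d ≤ 1 + log n` (Mathlib's `harmonic_le_one_add_log`, cast to `ℝ`)
      have h2 : ∑ d ∈ I, ((d : ℝ))⁻¹ ≤ 1 + Real.log (Nat.sqrt ⌊X⌋₊ : ℕ) := by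
        have h := harmonic_le_one_add_log (Nat.sqrt ⌊X⌋₊)
        have hcast : ((harmonic (Nat.sqrt ⌊X⌋₊) : ℚ) : ℝ) = ∑ d ∈ I, ((d : ℝ))⁻¹ := by
          rw [harmonic_eq_sum_Icc, hI]; push_cast; rfl
        rwa [hcast] at h
      have hfl : 1 ≤ ⌊X⌋₊ := Nat.le_floor (by exact_mod_cast hX)
      have hn1 : 1 ≤ Nat.sqrt ⌊X⌋₊ := Nat.sqrt_pos.mpr hfl
      have hnX : ((Nat.sqrt ⌊X⌋₊ : ℕ) : ℝ) ≤ X := by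
        have h := Nat.sqrt_le_self ⌊X⌋₊
        calc ((Nat.sqrt ⌊X⌋₊ : ℕ) : ℝ) ≤ ⌊X⌋₊ := by exact_mod_cast h
          _ ≤ X := Nat.floor_le hX0.le
      have h3 : Real.log (Nat.sqrt ⌊X⌋₊ : ℕ) ≤ Real.log X :=
        Real.log_le_log (by exact_mod_cast hn1) hnX
      have h4 := one_add_log_le_mul_rpow_half hX hε
      have h5 : X ^ (ε / 2) ≤ (X * Y) ^ (ε / 2) :=
        Real.rpow_le_rpow hX0.le (le_mul_of_one_le_right hX0.le hY) (by positivity)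
      have h6 : (0 : ℝ) ≤ 1 + 2 / ε := by positivity
      calc ∑ d ∈ I.filter P, ((d : ℝ))⁻¹ ≤ ∑ d ∈ I, ((d : ℝ))⁻¹ := h1
        _ ≤ 1 + Real.log (Nat.sqrt ⌊X⌋₊ : ℕ) := h2
        _ ≤ 1 + Real.log X := by linarith
        _ ≤ (1 + 2 / ε) * X ^ (ε / 2) := h4
        _ ≤ (1 + 2 / ε) * (X * Y) ^ (ε / 2) := mul_le_mul_of_nonneg_left h5 h6
    have hcard : ((I.filter P).card : ℝ) ≤ X * Y ^ (-(1 / 6 : ℝ)) * (X * Y) ^ (ε / 2) := by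
      set D₁ : ℝ := X ^ ((6 + 2 * η) / (6 + 4 * η)) * Y ^ (-(1 / (6 + 4 * η))) with hD₁
      have hD₁0 : 0 ≤ D₁ := by positivity
      have hsub : I.filter P ⊆ Finset.Icc 1 ⌊D₁⌋₊ := by
        intro d hd
        obtain ⟨hdI, hdP⟩ := Finset.mem_filter.mp hd
        obtain ⟨hd1, -⟩ := hImem d hdI
        exact Finset.mem_Icc.mpr ⟨hd1, Nat.le_floor (natCast_le_of_cap hη0 hX0 hY0 hd1 hdP)⟩
      calc ((I.filter P).card : ℝ) ≤ ((Finset.Icc 1 ⌊D₁⌋₊).card : ℝ) := by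
            exact_mod_cast Finset.card_le_card hsub
        _ = ⌊D₁⌋₊ := by simp
        _ ≤ D₁ := Nat.floor_le hD₁0
        _ ≤ X * Y ^ (-(1 / 6 : ℝ)) * (X * Y) ^ (ε / 2) := cap_le_law hη0 hηε hX hY
    have hXY6 : 0 ≤ X * Y ^ (-(1 / 6 : ℝ)) := by positivity
    have hrhs : ∑ d ∈ I.filter P, C₁ * (X * Y) ^ (ε / 2) * (X * Y ^ (-(1 / 6 : ℝ)) / d + 1) =
        C₁ * (X * Y) ^ (ε / 2) * (X * Y ^ (-(1 / 6 : ℝ)) * ∑ d ∈ I.filter P, ((d : ℝ))⁻¹ +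
          ((I.filter P).card : ℝ)) := by
      simp only [div_eq_mul_inv, Finset.mul_sum, mul_add, mul_one, Finset.sum_add_distrib, Finset.sum_const,
        nsmul_eq_mul]
      ring
    rw [hrhs] at hsumA
    have hε2 : (X * Y) ^ (ε / 2) * (X * Y) ^ (ε / 2) = (X * Y) ^ ε := by
      rw [← Real.rpow_add (by positivity)]; ring_nf
    calc ∑ d ∈ I.filter P, ((S d).ncard : ℝ)
        ≤ C₁ * (X * Y) ^ (ε / 2) * (X * Y ^ (-(1 / 6 : ℝ)) * ∑ d ∈ I.filter P, ((d : ℝ))⁻¹ +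
            ((I.filter P).card : ℝ)) := hsumA
      _ ≤ C₁ * (X * Y) ^ (ε / 2) * (X * Y ^ (-(1 / 6 : ℝ)) * ((1 + 2 / ε) * (X * Y) ^ (ε / 2)) +
            X * Y ^ (-(1 / 6 : ℝ)) * (X * Y) ^ (ε / 2)) := by
          apply mul_le_mul_of_nonneg_left _ (by positivity)
          exact add_le_add (mul_le_mul_of_nonneg_left hH hXY6) hcard
      _ = C₁ * (2 + 2 / ε) * ((X * Y) ^ (ε / 2) * (X * Y) ^ (ε / 2)) * (X * Y ^ (-(1 / 6 : ℝ))) := by ring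
      _ = C₁ * (2 + 2 / ε) * (X * Y) ^ ε * (X * Y ^ (-(1 / 6 : ℝ))) := by rw [hε2]
  -- (B) the tail fibres
  have hB : ∑ d ∈ I.filter (fun d => ¬ P d), ((S d).ncard : ℝ) ≤ KB := by
    have hterm : ∀ d ∈ I.filter (fun d => ¬ P d),
        ((S d).ncard : ℝ) ≤ if (d : ℝ) < DB then (F.ncard : ℝ) else 0 := by
      intro d hd
      obtain ⟨hdI, hdP⟩ := Finset.mem_filter.mp hd
      obtain ⟨hd1, hdX⟩ := hImem d hdI
      have hcap : (X / (d : ℝ) ^ 2) ^ (6 + 2 * η) < Y / (d : ℝ) ^ 6 := not_le.mp hdP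
      have hdR1 : (1 : ℝ) ≤ d := by exact_mod_cast hd1
      have hd2 : (0 : ℝ) < (d : ℝ) ^ 2 := by positivity
      have hXd : 1 ≤ X / (d : ℝ) ^ 2 := by rwa [le_div_iff₀ hd2, one_mul]
      have hsubF : S d ⊆ F := twistFibre_tail_subset hη0 hC₂0 hC₂ hXd hcap
      split_ifs with hlt
      · exact_mod_cast Set.ncard_le_ncard hsubF hFfin
      · -- `d ≥ DB` forces the fibre to be empty (`twistFibre_tail_d_lt`)
        have hempty : S d = ∅ := by
          by_contra hne
          exact hlt (twistFibre_tail_d_lt hη0 hC₂0 hC₂ hκ₁3 hκ₁Y hd1 hdX hcap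
            (Set.nonempty_iff_ne_empty.mpr hne))
        simp [hempty]
    have hsumB := Finset.sum_le_sum hterm
    rw [Finset.sum_ite, Finset.sum_const_zero, add_zero, Finset.sum_const, nsmul_eq_mul] at hsumB
    have hcardB : ((((I.filter (fun d => ¬ P d)).filter (fun d : ℕ => (d : ℝ) < DB)).card : ℕ) : ℝ) ≤ DB + 1 := by
      have hsub : (I.filter (fun d => ¬ P d)).filter (fun d : ℕ => (d : ℝ) < DB) ⊆ Finset.Icc 1 ⌊DB⌋₊ := by
        intro d hd
        obtain ⟨hd', hdlt⟩ := Finset.mem_filter.mp hd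
        obtain ⟨hdI, -⟩ := Finset.mem_filter.mp hd'
        obtain ⟨hd1, -⟩ := hImem d hdI
        exact Finset.mem_Icc.mpr ⟨hd1, Nat.le_floor hdlt.le⟩
      calc ((((I.filter (fun d => ¬ P d)).filter (fun d : ℕ => (d : ℝ) < DB)).card : ℕ) : ℝ)
          ≤ ((Finset.Icc 1 ⌊DB⌋₊).card : ℝ) := by exact_mod_cast Finset.card_le_card hsub
        _ = ⌊DB⌋₊ := by simp
        _ ≤ DB := Nat.floor_le hDB0
        _ ≤ DB + 1 := by linarith
    exact hsumB.trans (mul_le_mul_of_nonneg_right hcardB (by positivity))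
  -- assembly: cover, split, (A) + (B), and absorb the constants
  have hXYε : 1 ≤ (X * Y) ^ ε := Real.one_le_rpow hXY1 hε.le
  have hL0 : 0 ≤ X * Y ^ (-(1 / 6 : ℝ)) := by positivity
  have hTL : 1 ≤ (X * Y) ^ ε * (X * Y ^ (-(1 / 6 : ℝ)) + 1) :=
    one_le_mul_of_one_le_of_one_le hXYε (by linarith)
  have hKB1 : KB ≤ KB * ((X * Y) ^ ε * (X * Y ^ (-(1 / 6 : ℝ)) + 1)) := le_mul_of_one_le_right hKB0 hTL
  have hC0 : 0 ≤ C₁ * (2 + 2 / ε) * (X * Y) ^ ε := by positivity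
  calc ((cuspShell X Y).ncard : ℝ) ≤ ∑ d ∈ I, ((S d).ncard : ℝ) := hcover
    _ = _ := hsplit
    _ ≤ C₁ * (2 + 2 / ε) * (X * Y) ^ ε * (X * Y ^ (-(1 / 6 : ℝ))) + KB := add_le_add hA hB
    _ ≤ (C₁ * (2 + 2 / ε) + KB) * (X * Y) ^ ε * (X * Y ^ (-(1 / 6 : ℝ)) + 1) := by
        have h3 : (C₁ * (2 + 2 / ε) + KB) * (X * Y) ^ ε * (X * Y ^ (-(1 / 6 : ℝ)) + 1) =
            C₁ * (2 + 2 / ε) * (X * Y) ^ ε * (X * Y ^ (-(1 / 6 : ℝ))) +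
              (C₁ * (2 + 2 / ε) * (X * Y) ^ ε + KB * ((X * Y) ^ ε * (X * Y ^ (-(1 / 6 : ℝ)) + 1))) := by
          ring
        rw [h3]
        linarith

end Summit.ABC.ABC.Theorems.SharpModerateLaw

end
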